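import Literature.AnabelianGeometry.EtaleTheta.Discharge.Sec5Thm57KummerRigid
import Literature.AnabelianGeometry.EtaleTheta.Discharge.Sec5Thm57RigidOfKummerComparison
import Literature.AnabelianGeometry.EtaleTheta.Discharge.Sec5Thm57HCOfEtaleRigidity

/-!
# [EtTh] §5, Theorem 5.7, the (C)-chain WITHOUT roots of unity: `c^{2l} = 1` from the TORSION of the Kummer cocycle of the
# discrepancy, levelwise (pp. 329–331 / PDF pp. 103–105)

Mochizuki, *The étale theta function and its Frobenioid-theoretic manifestations*, Publ. RIMS **45** (2009)
[cite: MochizukiEtTh2009, Thm 5.7 proof p.330 (PDF p.104); Rmk 4.3.2 p.318–319 (PDF pp.92–93); Lem 5.8 p.331 (PDF p.105);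
Prop 3.2 (iii) p.296 (PDF p.70); Cor 2.8 (i) p.268 (PDF p.42); Prop 4.3 (iii) p.317 (PDF p.91)].
Seat abc-iut-w6-d049 (gen 5; node `EtTh:Thm5.7`, abc-iut-L2-lead (gen 5) R633 «R535 (b) hC5/hκ — the (tor) content», junction
note J-L2d3-1 of abc-iut-L2-d3 and ruling R664).  PROOF-ONLY (0 definitions, nothing landed is edited or restated) over
abc-iut-L2-d4's `Sec5Thm57KummerRigid.lean` (p445072) / `Sec5Thm57RigidOfKummerComparison.lean` (p448195) /
`Sec5Thm57HCOfEtaleRigidity.lean` (p453757) and abc-iut-w6-d077's `Sec5Thm57Constants.lean`.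

THE POINT.  The (C)-binder of record `hrigid` (p445072) asks, at every level `N`, for an `N`-th root `ξ_N ∈ O^×(B_N)` of ONE
`ζ ∈ μ_{2l}(K)` with `w_N·ξ_N⁻¹` fixed by `Π^tp_Y`.  At the COHERENT family — the only place it is instantiated (J-L2d3-1 (2),
R664) — `w_N^N = c` (`hpow`), so `hrigid` holds with `ζ := c`, `ξ_N := w_N` as soon as `c^{2l} = 1`: it is EQUIVALENT to the
conclusion and the root-of-unity currency carries no slack.  Print's last paragraph (p.330 with Rmk. 4.3.2 and Prop. 3.2 (iii):
«a compatible system of Kummer classes … suffices to distinguish») is used here in the form that needs NO `ζ`, NO `N`-th root of a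
constant and NO uniformity in `N`:
* `exists_const_pow_eq_of_kummerTorsion` (ONE level, generic `𝔉`): if the Kummer cocycle of `w^n` along `H_{B_N}`
  (`h ↦ s^⊔-gp_N(h)·w^n·s^⊔-gp_N(h)⁻¹·w^{−n}`) is the Kummer cocycle of a TORSION unit `u ∈ μ_N(B_N)` (a coboundary), then
  `w^n·u⁻¹` is `H_{B_N}`-fixed, `Π_Y`-fixed (`hfac`, GAP G-L2d4-1 shape), a constant `d` (Lemma 5.8, `hgc`), and `d^N = c^n`;
* `pow_two_l_eq_one_of_kummerTorsion` (tower): that clause with `n := 2l` on a COFINAL set of levels + `⋂_N (K^×)^N = 1` (`hK`)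
  ⟹ `c^{2l} = 1` — p445072's `pow_two_l_eq_one_of_kummerRigid` with `hrigid` REPLACED by the torsion clause `htors`;
* `kummerTorsion_of_etaleTorsion` (ONE level, p453757 currency): `htors` ⟸ the ÉTALE torsion clause
  «`κ^n` is a coboundary: `∃ d : μ_N, ∀ k, κ(k)^n = d·(χ(aug k) d)⁻¹`» for any `κ : Π^tp_Ÿ → μ_N` whose transport through
  `m : μ_N(B_N) ⥲ μ_N` is the Kummer cocycle of `w` (p453757's `hκ` AT `ξ := w` — the HC-tautology shape of J-L2d3-1 (1)), using
  abc-iut-L2-t4's dictionary `CyclotomicCharacterCompat` («`Π^tp_Y` acts on `μ_N(B_N)` via the cyclotomic character») and Prop. 4.3 (iii);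
* `exists_const_pow_eq_of_etaleTorsion`, `thetaRootPreservedAll_of_anchoredFamily_of_kummerTorsion` — the per-level composite and
  p445072's Thm. 5.7 closer with `hrigid ↦ htors` (torsion asked only on a cofinal set of levels, e.g. the index set of a
  `ThetaEnvTower`).
NET for the (C) knit: the residual étale input per level is «`κ_N^{2l}` is a coboundary» for the cocycle `κ_N` of `hC5` at
`γ_Δ := φΛ` — what Cor. 2.8 (i) (`l`-torsion of the constant multiple) × the sign `μ₂` × translation-freeness assert — and the
clause «`κ` is inflated» is never used.
HONEST FRAMING: kernel-checked implications between typed statements under named hypotheses; none of `hK`/`hgc`/`hfac`/`htors`/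
`CyclotomicCharacterCompat` is proved here; nothing of [EtTh] is asserted unconditionally; typed ≠ discharged; no side taken on
anything downstream ([IUTchIII] Cor. 3.12 in particular).
-/

namespace Literature.AnabelianGeometry.EtaleTheta

open CategoryTheory
open Literature.AlgebraicGeometry.Frobenioids

universe w v v' u u'

/-- **Kummer cocycles are multiplicative in the unit**: for `w` in an abelian normal subgroup `U` and any `c`,
`c·w^n·c⁻¹·w^{−n} = (c·w·c⁻¹·w⁻¹)^n`.  [cite: MochizukiEtTh2009, Lem 5.8 proof p.331 (PDF p.105)] -/
theorem conj_pow_mul_inv_pow_eq_pow {G : Type*} [Group G] (U : Subgroup G) [U.Normal] [IsMulCommutative U]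
    {w : G} (hw : w ∈ U) (c : G) (n : ℕ) :
    c * w ^ n * c⁻¹ * (w ^ n)⁻¹ = (c * w * c⁻¹ * w⁻¹) ^ n := by
  have hcw : c * w * c⁻¹ ∈ U := ‹U.Normal›.conj_mem w hw c
  have hcomm : Commute (c * w * c⁻¹) w⁻¹ := setLike_mul_comm (s := U) hcw (inv_mem hw)
  rw [hcomm.mul_pow, conj_pow, inv_pow]

namespace ThetaFrobenioid

variable {C : Type u} [Category.{v} C] {D : Type u'} [Category.{v'} D] {𝔉 : ThetaFrobenioid.{w} C D}

/-- **One level: a torsion Kummer cocycle forces `c^n ∈ (K^×)^N`.**  Data: Prop. 4.3 (iii) (`hdiff`), the factorisation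
`hfac` (GAP G-L2d4-1), Lemma 5.8 (`hgc`: `Π_Y`-fixed units of `B_N` are constants), a unit `w ∈ O^×(B_N)` with `w^N = c`
in `O^×(B_N^birat)` (`hpow`), and `htors`: the Kummer cocycle of `w^n` along `H_{B_N}` equals that of some `u ∈ μ_N(B_N)`.
Then `∃ d ∈ K^×, d^N = c^n` (`d :=` the constant `w^n·u⁻¹`).
[cite: MochizukiEtTh2009, Thm 5.7 proof p.330 (PDF p.104); Lem 5.8 p.331 (PDF p.105); Prop 4.3 (iii) p.317 (PDF p.91)] -/
theorem exists_const_pow_eq_of_kummerTorsion (hdiff : 𝔉.BiKummerDifferenceMem)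
    (hfac : ∀ y ∈ 𝔉.imPiY, ∃ x ∈ 𝔉.HB, ∀ u ∈ 𝔉.units 𝔉.BN,
      𝔉.sgpCap y * u * (𝔉.sgpCap y)⁻¹ = 𝔉.sgpCap x * u * (𝔉.sgpCap x)⁻¹)
    (hgc : ∀ u : 𝔉.units 𝔉.BN,
      (∀ y ∈ 𝔉.imPiY, 𝔉.sgpCap y * (u : Aut 𝔉.BN) * (𝔉.sgpCap y)⁻¹ = u) →
        𝔉.unitsToBirat 𝔉.BN u ∈ 𝔉.constEmb.range)
    {w : Aut 𝔉.BN} (hw : w ∈ 𝔉.units 𝔉.BN) {c : 𝔉.Kˣ}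
    (hpow : 𝔉.unitsToBirat 𝔉.BN ⟨w, hw⟩ ^ (𝔉.N : ℕ) = 𝔉.constEmb c) (n : ℕ)
    (htors : ∃ u ∈ 𝔉.muTorsion 𝔉.BN 𝔉.N, ∀ k : 𝔉.PiYdd,
      𝔉.sgpCup (𝔉.rhoYdd k) * w ^ n * (𝔉.sgpCup (𝔉.rhoYdd k))⁻¹ * (w ^ n)⁻¹ =
        𝔉.sgpCup (𝔉.rhoYdd k) * u * (𝔉.sgpCup (𝔉.rhoYdd k))⁻¹ * u⁻¹) :
    ∃ d : 𝔉.Kˣ, d ^ (𝔉.N : ℕ) = c ^ n := by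
  haveI := 𝔉.units_normal 𝔉.BN
  haveI : IsMulCommutative (𝔉.units 𝔉.BN) := 𝔉.units_comm 𝔉.BN
  obtain ⟨u, hu, hκ⟩ := htors
  have huU : u ∈ 𝔉.units 𝔉.BN := 𝔉.muTorsion_le_units _ _ hu
  have hwn : w ^ n ∈ 𝔉.units 𝔉.BN := pow_mem hw n
  have hv : w ^ n * u⁻¹ ∈ 𝔉.units 𝔉.BN := mul_mem hwn (inv_mem huU)
  -- `w^n·u⁻¹` commutes with `s^⊔-gp_N(h)` for every `h ∈ H_{B_N}` (equal Kummer cocycles)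
  have hcup : ∀ h : 𝔉.HB, 𝔉.sgpCup h * (w ^ n * u⁻¹) * (𝔉.sgpCup h)⁻¹ = w ^ n * u⁻¹ := by
    intro h
    obtain ⟨x, hx, hxh⟩ := Subgroup.mem_map.mp h.2
    have hk : 𝔉.rhoYdd ⟨x, hx⟩ = h := Subtype.ext hxh
    rw [← hk]
    exact conj_eq_of_kummerCocycle_eq (𝔉.units 𝔉.BN) hwn huU (𝔉.sgpCup _) (hκ ⟨x, hx⟩)
  -- hence with `s^⊓-gp_N(h)` (Prop. 4.3 (iii): the two conjugations agree on units)
  have hcap : ∀ h : 𝔉.HB, 𝔉.sgpCap (h : Aut (𝔉.base.obj 𝔉.BN)) * (w ^ n * u⁻¹) *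
      (𝔉.sgpCap (h : Aut (𝔉.base.obj 𝔉.BN)))⁻¹ = w ^ n * u⁻¹ := by
    intro h
    have hcc := kummerCocycleCap_eq_kummerCocycleCup (𝔉 := 𝔉) hdiff hv h
    rw [hcup h, mul_inv_cancel] at hcc
    exact mul_inv_eq_one.mp hcc
  -- `Π_Y`-fixed (factorisation through `H_{B_N}`), hence a constant `d` (Lemma 5.8)
  have hY : ∀ y ∈ 𝔉.imPiY, 𝔉.sgpCap y * (w ^ n * u⁻¹) * (𝔉.sgpCap y)⁻¹ = w ^ n * u⁻¹ := by
    intro y hy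
    obtain ⟨x, hx, hxy⟩ := hfac y hy
    rw [hxy _ hv]
    exact hcap ⟨x, hx⟩
  obtain ⟨d, hd⟩ := hgc ⟨w ^ n * u⁻¹, hv⟩ hY
  refine ⟨d, 𝔉.constEmb_injective ?_⟩
  -- `d^N = c^n` read in `O^×(B_N^birat)`: `(w^n u⁻¹)^N = (w^N)^n · (u^N)⁻¹ = c^n`
  have hsplit : (⟨w ^ n * u⁻¹, hv⟩ : 𝔉.units 𝔉.BN) = ⟨w, hw⟩ ^ n * ⟨u, huU⟩⁻¹ :=
    Subtype.ext (by rw [Subgroup.coe_mul, Subgroup.coe_inv, Subgroup.coe_pow])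
  have htor : (⟨u, huU⟩ : 𝔉.units 𝔉.BN) ^ (𝔉.N : ℕ) = 1 :=
    Subtype.ext (by rw [Subgroup.coe_pow, Subgroup.coe_one]; exact (𝔉.mem_muTorsion.mp hu).2)
  rw [map_pow _ d, hd, hsplit, map_mul, map_inv, mul_pow, inv_pow, ← map_pow _ (⟨u, huU⟩ : 𝔉.units 𝔉.BN), htor,
    map_one, inv_one, mul_one, map_pow _ (⟨w, hw⟩ : 𝔉.units 𝔉.BN) n, ← pow_mul, mul_comm n, pow_mul, hpow]
  exact (map_pow _ _ _).symm

/-- **One level, étale ⟹ Frobenioid torsion** (the §5 ↔ §2 dictionary step of R-C5, p453757 currency).  Data: the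
dictionary `(T, ι, m)` with `IdentifiesPiYdd` and abc-iut-L2-t4's `CyclotomicCharacterCompat` («`Π^tp_Y` acts on `μ_N(B_N)`
via the cyclotomic character», Lemma 5.8 proof p.331), Prop. 4.3 (iii) (`hdiff`), a unit `w`, and a `μ_N`-valued function `κ`
on `Π^tp_Ÿ` whose transport `m⁻¹ ∘ κ ∘ ι` IS the Kummer cocycle of `w` along `H_{B_N}` (p453757's `hκ` at `ξ := w`).  If
`κ^n` is a COBOUNDARY (`htors`: `κ(k)^n = d·(χ(aug k) d)⁻¹`), then the Kummer cocycle of `w^n` along `H_{B_N}` is that of the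
torsion unit `(m⁻¹ d)⁻¹ ∈ μ_N(B_N)`.  [cite: MochizukiEtTh2009, Thm 5.7 proof p.330 (PDF p.104); Lem 5.8 proof p.331 (PDF p.105); Cor 2.8 (i) p.268 (PDF p.42)] -/
theorem kummerTorsion_of_etaleTorsion (T : ThetaEnvData.{v} 𝔉.N) (ι : 𝔉.PiX ≃* T.PiX)
    (m : 𝔉.muTorsion 𝔉.BN 𝔉.N ≃* T.mu) (hι : 𝔉.IdentifiesPiYdd T ι) (hχ : 𝔉.CyclotomicCharacterCompat T ι m)
    (hdiff : 𝔉.BiKummerDifferenceMem) {w : Aut 𝔉.BN} (hw : w ∈ 𝔉.units 𝔉.BN) (κ : T.PiYdd → T.mu)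
    (hκ : ∀ k : 𝔉.PiYdd, ((m.symm (κ ⟨ι k, (hι k).mp k.2⟩) : 𝔉.muTorsion 𝔉.BN 𝔉.N) : Aut 𝔉.BN) =
      𝔉.sgpCup (𝔉.rhoYdd k) * w * (𝔉.sgpCup (𝔉.rhoYdd k))⁻¹ * w⁻¹)
    (n : ℕ)
    (htors : ∃ d : T.mu, ∀ k : T.PiYdd, κ k ^ n = CycEnvelope.coboundary (T.aug.comp T.PiYdd.subtype) T.chi d k) :
    ∃ u ∈ 𝔉.muTorsion 𝔉.BN 𝔉.N, ∀ k : 𝔉.PiYdd,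
      𝔉.sgpCup (𝔉.rhoYdd k) * w ^ n * (𝔉.sgpCup (𝔉.rhoYdd k))⁻¹ * (w ^ n)⁻¹ =
        𝔉.sgpCup (𝔉.rhoYdd k) * u * (𝔉.sgpCup (𝔉.rhoYdd k))⁻¹ * u⁻¹ := by
  haveI := 𝔉.units_normal 𝔉.BN
  haveI : IsMulCommutative (𝔉.units 𝔉.BN) := 𝔉.units_comm 𝔉.BN
  obtain ⟨d, hd⟩ := htors
  have heU : ((m.symm d : 𝔉.muTorsion 𝔉.BN 𝔉.N) : Aut 𝔉.BN) ∈ 𝔉.units 𝔉.BN :=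
    𝔉.muTorsion_le_units _ _ (m.symm d).2
  refine ⟨((m.symm d : 𝔉.muTorsion 𝔉.BN 𝔉.N) : Aut 𝔉.BN)⁻¹, inv_mem (m.symm d).2, fun k => ?_⟩
  -- (1) the Kummer cocycle of `w^n` is the `n`-th power of that of `w`, i.e. of `m⁻¹(κ(ι k))`
  have h1 := conj_pow_mul_inv_pow_eq_pow (𝔉.units 𝔉.BN) hw (𝔉.sgpCup (𝔉.rhoYdd k)) n
  have h2 : (𝔉.sgpCup (𝔉.rhoYdd k) * w * (𝔉.sgpCup (𝔉.rhoYdd k))⁻¹ * w⁻¹) ^ n =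
      ((m.symm (κ ⟨ι k, (hι k).mp k.2⟩ ^ n) : 𝔉.muTorsion 𝔉.BN 𝔉.N) : Aut 𝔉.BN) := by
    rw [← hκ k, map_pow, Subgroup.coe_pow]
  -- (2) the étale torsion clause at `ι k`
  have h3 : κ ⟨ι k, (hι k).mp k.2⟩ ^ n = d * (T.chi (T.aug (ι k)) d)⁻¹ := hd ⟨ι k, (hι k).mp k.2⟩
  -- (3) `m⁻¹` transports `χ(aug(ι k))` to conjugation by `s^⊓-gp_N(ρ k)` (the dictionary), = by `s^⊔-gp_N(ρ k)` on units
  have hkY : (k : 𝔉.PiX) ∈ 𝔉.PiY := 𝔉.PiYdd_le k.2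
  have hmem : 𝔉.sgpCap (𝔉.ρ k) * ((m.symm d : 𝔉.muTorsion 𝔉.BN 𝔉.N) : Aut 𝔉.BN) * (𝔉.sgpCap (𝔉.ρ k))⁻¹ ∈
      𝔉.muTorsion 𝔉.BN 𝔉.N :=
    (𝔉.muTorsion_normal 𝔉.BN 𝔉.N).conj_mem _ (m.symm d).2 _
  have h4 : ((m.symm (T.chi (T.aug (ι k)) d) : 𝔉.muTorsion 𝔉.BN 𝔉.N) : Aut 𝔉.BN) =
      𝔉.sgpCap (𝔉.ρ k) * ((m.symm d : 𝔉.muTorsion 𝔉.BN 𝔉.N) : Aut 𝔉.BN) * (𝔉.sgpCap (𝔉.ρ k))⁻¹ := by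
    have key := hχ k hkY (m.symm d) ⟨_, hmem⟩ rfl
    rw [MulEquiv.apply_symm_apply] at key
    rw [← key, MulEquiv.symm_apply_apply]
  have h5 : 𝔉.sgpCap (𝔉.ρ k) * ((m.symm d : 𝔉.muTorsion 𝔉.BN 𝔉.N) : Aut 𝔉.BN) * (𝔉.sgpCap (𝔉.ρ k))⁻¹ =
      𝔉.sgpCup (𝔉.rhoYdd k) * ((m.symm d : 𝔉.muTorsion 𝔉.BN 𝔉.N) : Aut 𝔉.BN) * (𝔉.sgpCup (𝔉.rhoYdd k))⁻¹ :=
    mul_right_cancel (kummerCocycleCap_eq_kummerCocycleCup (𝔉 := 𝔉) hdiff heU (𝔉.rhoYdd k))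
  have hseU : 𝔉.sgpCup (𝔉.rhoYdd k) * ((m.symm d : 𝔉.muTorsion 𝔉.BN 𝔉.N) : Aut 𝔉.BN) *
      (𝔉.sgpCup (𝔉.rhoYdd k))⁻¹ ∈ 𝔉.units 𝔉.BN := (𝔉.units_normal 𝔉.BN).conj_mem _ heU _
  have hc : ((m.symm d : 𝔉.muTorsion 𝔉.BN 𝔉.N) : Aut 𝔉.BN) *
      (𝔉.sgpCup (𝔉.rhoYdd k) * ((m.symm d : 𝔉.muTorsion 𝔉.BN 𝔉.N) : Aut 𝔉.BN) * (𝔉.sgpCup (𝔉.rhoYdd k))⁻¹)⁻¹ =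
      (𝔉.sgpCup (𝔉.rhoYdd k) * ((m.symm d : 𝔉.muTorsion 𝔉.BN 𝔉.N) : Aut 𝔉.BN) * (𝔉.sgpCup (𝔉.rhoYdd k))⁻¹)⁻¹ *
        ((m.symm d : 𝔉.muTorsion 𝔉.BN 𝔉.N) : Aut 𝔉.BN) :=
    setLike_mul_comm (s := 𝔉.units 𝔉.BN) heU (inv_mem hseU)
  calc 𝔉.sgpCup (𝔉.rhoYdd k) * w ^ n * (𝔉.sgpCup (𝔉.rhoYdd k))⁻¹ * (w ^ n)⁻¹
      = ((m.symm (κ ⟨ι k, (hι k).mp k.2⟩ ^ n) : 𝔉.muTorsion 𝔉.BN 𝔉.N) : Aut 𝔉.BN) := h1.trans h2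
    _ = ((m.symm d : 𝔉.muTorsion 𝔉.BN 𝔉.N) : Aut 𝔉.BN) *
          (𝔉.sgpCup (𝔉.rhoYdd k) * ((m.symm d : 𝔉.muTorsion 𝔉.BN 𝔉.N) : Aut 𝔉.BN) *
            (𝔉.sgpCup (𝔉.rhoYdd k))⁻¹)⁻¹ := by
        rw [h3, map_mul, map_inv, Subgroup.coe_mul, Subgroup.coe_inv, h4, h5]
    _ = 𝔉.sgpCup (𝔉.rhoYdd k) * ((m.symm d : 𝔉.muTorsion 𝔉.BN 𝔉.N) : Aut 𝔉.BN)⁻¹ *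
          (𝔉.sgpCup (𝔉.rhoYdd k))⁻¹ * ((m.symm d : 𝔉.muTorsion 𝔉.BN 𝔉.N) : Aut 𝔉.BN)⁻¹⁻¹ := by
        rw [hc, inv_inv]; group

/-- **One level, the composite**: from the dictionary `(T, ι, m)` + `CyclotomicCharacterCompat` + Prop. 4.3 (iii) + `hfac` +
Lemma 5.8 (`hgc`) + `w^N = c` + `m⁻¹ ∘ κ ∘ ι =` the Kummer cocycle of `w` + «`κ^n` is a coboundary» ⟹ `∃ d ∈ K^×, d^N = c^n`.
[cite: MochizukiEtTh2009, Thm 5.7 proof p.330 (PDF p.104); Lem 5.8 p.331 (PDF p.105)] -/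
theorem exists_const_pow_eq_of_etaleTorsion (T : ThetaEnvData.{v} 𝔉.N) (ι : 𝔉.PiX ≃* T.PiX)
    (m : 𝔉.muTorsion 𝔉.BN 𝔉.N ≃* T.mu) (hι : 𝔉.IdentifiesPiYdd T ι) (hχ : 𝔉.CyclotomicCharacterCompat T ι m)
    (hdiff : 𝔉.BiKummerDifferenceMem)
    (hfac : ∀ y ∈ 𝔉.imPiY, ∃ x ∈ 𝔉.HB, ∀ u ∈ 𝔉.units 𝔉.BN,
      𝔉.sgpCap y * u * (𝔉.sgpCap y)⁻¹ = 𝔉.sgpCap x * u * (𝔉.sgpCap x)⁻¹)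
    (hgc : ∀ u : 𝔉.units 𝔉.BN,
      (∀ y ∈ 𝔉.imPiY, 𝔉.sgpCap y * (u : Aut 𝔉.BN) * (𝔉.sgpCap y)⁻¹ = u) →
        𝔉.unitsToBirat 𝔉.BN u ∈ 𝔉.constEmb.range)
    {w : Aut 𝔉.BN} (hw : w ∈ 𝔉.units 𝔉.BN) {c : 𝔉.Kˣ}
    (hpow : 𝔉.unitsToBirat 𝔉.BN ⟨w, hw⟩ ^ (𝔉.N : ℕ) = 𝔉.constEmb c) (κ : T.PiYdd → T.mu)
    (hκ : ∀ k : 𝔉.PiYdd, ((m.symm (κ ⟨ι k, (hι k).mp k.2⟩) : 𝔉.muTorsion 𝔉.BN 𝔉.N) : Aut 𝔉.BN) =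
      𝔉.sgpCup (𝔉.rhoYdd k) * w * (𝔉.sgpCup (𝔉.rhoYdd k))⁻¹ * w⁻¹)
    (n : ℕ)
    (htors : ∃ d : T.mu, ∀ k : T.PiYdd, κ k ^ n = CycEnvelope.coboundary (T.aug.comp T.PiYdd.subtype) T.chi d k) :
    ∃ d : 𝔉.Kˣ, d ^ (𝔉.N : ℕ) = c ^ n :=
  exists_const_pow_eq_of_kummerTorsion hdiff hfac hgc hw hpow n
    (kummerTorsion_of_etaleTorsion T ι m hι hχ hdiff hw κ hκ n htors)

end ThetaFrobenioid

namespace ThetaFrobenioidTower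

variable {C : Type u} [Category.{v} C] {D : Type u'} [Category.{v'} D] (𝔗 : ThetaFrobenioidTower.{w} C D)
  (Ψ : C ≌ C)

/-- **`c^{2l} = 1` from the torsion of the Kummer cocycle of the discrepancy on a COFINAL set of levels** — p445072's
`pow_two_l_eq_one_of_kummerRigid` with the root-of-unity clause `hrigid` REPLACED by `htors`: for every level `N` of a cofinal
`S ⊆ ℕ≥1` (e.g. the index set of a `ThetaEnvTower`), the Kummer cocycle of `w_N^{2l}` along `H_{B_N}` is that of a torsion unit.
With `hK` (`⋂_N (K^×)^N = 1`, Prop. 3.2 (iii)), Lemma 5.8 at every level (`hgc`), the factorisation `hfac`, Prop. 4.3 (iii) (`hdiff`)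
and `w_N^N = c` (`hpow`): `c^{2l} = 1`.  [cite: MochizukiEtTh2009, Thm 5.7 p.330 (PDF p.104); Rmk 4.3.2 p.319 (PDF p.93); Prop 3.2 (iii) p.296 (PDF p.70)] -/
theorem pow_two_l_eq_one_of_kummerTorsion
    (hK : ∀ x : 𝔗.Kˣ, (∀ N : ℕ+, ∃ d : 𝔗.Kˣ, d ^ (N : ℕ) = x) → x = 1)
    {S : Set ℕ+} (hS : ∀ n : ℕ+, ∃ M ∈ S, n ∣ M)
    (hdiff : ∀ N ∈ S, (𝔗.atLevel N).BiKummerDifferenceMem)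
    (hfac : ∀ N ∈ S, ∀ y ∈ (𝔗.atLevel N).imPiY, ∃ x ∈ (𝔗.atLevel N).HB, ∀ u ∈ (𝔗.atLevel N).units (𝔗.BN N),
      𝔗.sgpCap N y * u * (𝔗.sgpCap N y)⁻¹ = 𝔗.sgpCap N x * u * (𝔗.sgpCap N x)⁻¹)
    (hgc : ∀ (N : ℕ+) (u : (𝔗.atLevel N).units (𝔗.BN N)),
      (∀ y ∈ (𝔗.atLevel N).imPiY, 𝔗.sgpCap N y * (u : Aut (𝔗.BN N)) * (𝔗.sgpCap N y)⁻¹ = u) →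
        (𝔗.atLevel N).unitsToBirat (𝔗.BN N) u ∈ (𝔗.constEmb N).range)
    {c : 𝔗.Kˣ} (wf : ∀ N : ℕ+, Aut (𝔗.BN N)) (hw : ∀ N : ℕ+, wf N ∈ (𝔗.atLevel N).units (𝔗.BN N))
    (hpow : ∀ N : ℕ+, (𝔗.atLevel N).unitsToBirat (𝔗.BN N) ⟨wf N, hw N⟩ ^ (N : ℕ) = 𝔗.constEmb N c)
    (htors : ∀ N ∈ S, ∃ u ∈ (𝔗.atLevel N).muTorsion (𝔗.BN N) N, ∀ k : (𝔗.atLevel N).PiYdd,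
      𝔗.sgpCup N ((𝔗.atLevel N).rhoYdd k) * wf N ^ (2 * 𝔗.l) * (𝔗.sgpCup N ((𝔗.atLevel N).rhoYdd k))⁻¹ *
          (wf N ^ (2 * 𝔗.l))⁻¹ =
        𝔗.sgpCup N ((𝔗.atLevel N).rhoYdd k) * u * (𝔗.sgpCup N ((𝔗.atLevel N).rhoYdd k))⁻¹ * u⁻¹) :
    c ^ (2 * 𝔗.l) = 1 := by
  refine hK _ fun N => ?_
  obtain ⟨M, hM, hNM⟩ := hS N
  obtain ⟨d, hd⟩ : ∃ d : 𝔗.Kˣ, d ^ ((M : ℕ+) : ℕ) = c ^ (2 * 𝔗.l) :=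
    ThetaFrobenioid.exists_const_pow_eq_of_kummerTorsion (𝔉 := 𝔗.atLevel M) (hdiff M hM) (hfac M hM) (hgc M) (hw M)
      (hpow M) (2 * 𝔗.l) (htors M hM)
  obtain ⟨q, hq⟩ := PNat.dvd_iff.mp hNM
  refine ⟨d ^ q, ?_⟩
  rw [← pow_mul, mul_comm q, ← hq]
  exact hd

/-- **[EtTh] Theorem 5.7 (root level) at ALL levels, anchored form, with the anabelian residual in TORSION shape** — p445072's
`thetaRootPreservedAll_of_anchoredFamily_of_kummerRigid` with `hrigid` (an `N`-th root of ONE `ζ ∈ μ_{2l}(K)` at every level)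
REPLACED by `htors` (at every level of a cofinal `S`: the Kummer cocycle of `w_N^{2l}` along `H_{B_N}` is that of a torsion unit),
plus Prop. 4.3 (iii) and the factorisation `hfac` at those levels.  The clause `w_N^N = c` is DERIVED from the coherence of the
family exactly as in p445072.  [cite: MochizukiEtTh2009, Thm 5.7 p.329–330 (PDF pp.103–104); Rmk 4.3.2 p.318–319 (PDF pp.92–93); Lem 5.8 p.331 (PDF p.105)] -/
theorem thetaRootPreservedAll_of_anchoredFamily_of_kummerTorsion (hepi : ∀ ⦃X Y : C⦄ (f : X ⟶ Y), Epi f)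
    (hconst : ∀ (N : ℕ+) (u : Aut (𝔗.BN N)) (hu : u ∈ (𝔗.atLevel N).units (𝔗.BN N)) (u₁ : Aut (𝔗.BN 1))
      (hu₁ : u₁ ∈ (𝔗.atLevel 1).units (𝔗.BN 1)) (c : 𝔗.Kˣ),
      u.hom ≫ 𝔗.β (one_dvd_level N) = 𝔗.β (one_dvd_level N) ≫ u₁.hom →
      (𝔗.atLevel 1).unitsToBirat (𝔗.BN 1) ⟨u₁, hu₁⟩ = 𝔗.constEmb 1 c →
        (𝔗.atLevel N).unitsToBirat (𝔗.BN N) ⟨u, hu⟩ ^ (N : ℕ) = 𝔗.constEmb N c)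
    (hcap₁ : (𝔗.atLevel 1).SgpCapSpec) (hcup₁ : (𝔗.atLevel 1).SgpCupSpec)
    (hdiff₁ : (𝔗.atLevel 1).BiKummerDifferenceMem) (h58₁ : (𝔗.atLevel 1).ConstantsActByCyclotome)
    (hfac₁ : ∀ y ∈ (𝔗.atLevel 1).imPiY, ∃ h ∈ (𝔗.atLevel 1).HB, ∀ u ∈ (𝔗.atLevel 1).units (𝔗.BN 1),
      𝔗.sgpCap 1 y * u * (𝔗.sgpCap 1 y)⁻¹ = 𝔗.sgpCap 1 h * u * (𝔗.sgpCap 1 h)⁻¹)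
    -- the anabelian residual, torsion shape (no root of unity)
    (hK : ∀ x : 𝔗.Kˣ, (∀ N : ℕ+, ∃ d : 𝔗.Kˣ, d ^ (N : ℕ) = x) → x = 1)
    (hgc : ∀ (N : ℕ+) (u : (𝔗.atLevel N).units (𝔗.BN N)),
      (∀ y ∈ (𝔗.atLevel N).imPiY, 𝔗.sgpCap N y * (u : Aut (𝔗.BN N)) * (𝔗.sgpCap N y)⁻¹ = u) →
        (𝔗.atLevel N).unitsToBirat (𝔗.BN N) u ∈ (𝔗.constEmb N).range)
    {S : Set ℕ+} (hS : ∀ n : ℕ+, ∃ M ∈ S, n ∣ M)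
    (hdiff : ∀ N ∈ S, (𝔗.atLevel N).BiKummerDifferenceMem)
    (hfac : ∀ N ∈ S, ∀ y ∈ (𝔗.atLevel N).imPiY, ∃ x ∈ (𝔗.atLevel N).HB, ∀ u ∈ (𝔗.atLevel N).units (𝔗.BN N),
      𝔗.sgpCap N y * u * (𝔗.sgpCap N y)⁻¹ = 𝔗.sgpCap N x * u * (𝔗.sgpCap N x)⁻¹)
    -- the normalised ANCHOR at the first root
    {α₁ : Ψ.functor.obj (𝔗.AN 1) ≅ 𝔗.AN 1} {β₁ : Ψ.functor.obj (𝔗.BN 1) ≅ 𝔗.BN 1} {u₁ : Aut (𝔗.BN 1)}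
    (hT₁ : α₁.inv ≫ Ψ.functor.map (𝔗.sCap 1) ≫ β₁.hom = 𝔗.sCap 1)
    (hT₁' : α₁.inv ≫ Ψ.functor.map (𝔗.sCup 1) ≫ β₁.hom = 𝔗.sCup 1 ≫ u₁.hom)
    (hu₁ : u₁ ∈ (𝔗.atLevel 1).units (𝔗.BN 1))
    (hU₁ : ((𝔗.atLevel 1).units (𝔗.BN 1)).map ((𝔗.atLevel 1).psiAut Ψ β₁) = (𝔗.atLevel 1).units (𝔗.BN 1))
    (θ₁ : Aut (𝔗.pre.base.obj (𝔗.BN 1)) ≃* Aut (𝔗.pre.base.obj (𝔗.BN 1)))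
    (hstrv₁ : (𝔗.atLevel 1).StrvTransport Ψ α₁ (Iso.refl _) θ₁)
    (hYdd₁ : (𝔗.atLevel 1).HB.map θ₁.toMonoidHom = (𝔗.atLevel 1).HB)
    -- the family, coherent with the anchor
    (a : ∀ N : ℕ+, Ψ.functor.obj (𝔗.AN N) ≅ 𝔗.AN N) (b : ∀ N : ℕ+, Ψ.functor.obj (𝔗.BN N) ≅ 𝔗.BN N)
    (w : ∀ N : ℕ+, Aut (𝔗.BN N))
    (hw : ∀ N : ℕ+, w N ∈ (𝔗.atLevel N).units (𝔗.BN N))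
    (hT : ∀ N : ℕ+, (a N).inv ≫ Ψ.functor.map (𝔗.sCap N) ≫ (b N).hom = 𝔗.sCap N)
    (hT' : ∀ N : ℕ+, (a N).inv ≫ Ψ.functor.map (𝔗.sCup N) ≫ (b N).hom = 𝔗.sCup N ≫ (w N).hom)
    (hΨα : ∀ N : ℕ+,
      (a N).inv ≫ Ψ.functor.map (𝔗.α (one_dvd_level N)) ≫ α₁.hom = 𝔗.α (one_dvd_level N))
    (hΨβ : ∀ N : ℕ+,
      (b N).inv ≫ Ψ.functor.map (𝔗.β (one_dvd_level N)) ≫ β₁.hom = 𝔗.β (one_dvd_level N))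
    -- torsion of the Kummer cocycles of the family's discrepancies (Cor. 2.8 (i) on Prop. 5.2 (iii)'s classes via Thm. 5.6)
    (htors : ∀ N ∈ S, ∃ u ∈ (𝔗.atLevel N).muTorsion (𝔗.BN N) N, ∀ k : (𝔗.atLevel N).PiYdd,
      𝔗.sgpCup N ((𝔗.atLevel N).rhoYdd k) * w N ^ (2 * 𝔗.l) * (𝔗.sgpCup N ((𝔗.atLevel N).rhoYdd k))⁻¹ *
          (w N ^ (2 * 𝔗.l))⁻¹ =
        𝔗.sgpCup N ((𝔗.atLevel N).rhoYdd k) * u * (𝔗.sgpCup N ((𝔗.atLevel N).rhoYdd k))⁻¹ * u⁻¹) :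
    𝔗.ThetaRootPreservedAll Ψ := by
  refine 𝔗.thetaRootPreservedAll_of_anchoredFamily Ψ hepi hconst hcap₁ hcup₁ hdiff₁ h58₁ hfac₁ hT₁ hT₁' hu₁ hU₁ θ₁ hstrv₁
    hYdd₁ ?_ a b w hw hT hT' hΨα hΨβ
  intro c hc₁
  refine 𝔗.pow_two_l_eq_one_of_kummerTorsion hK hS hdiff hfac hgc w hw (fun N => ?_) htors
  -- `w_N` is an `N`-th root of `c`: descent along `β_{1,N}` + the unit law (as in p445072)
  have hT₁r : α₁.inv ≫ Ψ.functor.map (𝔗.sCap 1) ≫ β₁.hom =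
      (Iso.refl (𝔗.AN 1)).hom ≫ 𝔗.sCap 1 ≫ (1 : Aut (𝔗.BN 1)).hom := by
    rw [hT₁, Iso.refl_hom, Category.id_comp]
    show 𝔗.sCap 1 = 𝔗.sCap 1 ≫ (Iso.refl (𝔗.BN 1)).hom
    rw [Iso.refl_hom, Category.comp_id]
  have hT₁r' : α₁.inv ≫ Ψ.functor.map (𝔗.sCup 1) ≫ β₁.hom =
      (Iso.refl (𝔗.AN 1)).hom ≫ 𝔗.sCup 1 ≫ u₁.hom := by
    rw [hT₁', Iso.refl_hom, Category.id_comp]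
  have hTr : (a N).inv ≫ Ψ.functor.map (𝔗.sCap N) ≫ (b N).hom =
      (Iso.refl (𝔗.AN N)).hom ≫ 𝔗.sCap N ≫ (1 : Aut (𝔗.BN N)).hom := by
    rw [hT N, Iso.refl_hom, Category.id_comp]
    show 𝔗.sCap N = 𝔗.sCap N ≫ (Iso.refl (𝔗.BN N)).hom
    rw [Iso.refl_hom, Category.comp_id]
  have hTr' : (a N).inv ≫ Ψ.functor.map (𝔗.sCup N) ≫ (b N).hom =
      (Iso.refl (𝔗.AN N)).hom ≫ 𝔗.sCup N ≫ (w N).hom := by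
    rw [hT' N, Iso.refl_hom, Category.id_comp]
  have he : 𝔗.α (one_dvd_level N) ≫ (Iso.refl (𝔗.AN 1)).hom = (Iso.refl (𝔗.AN N)).hom ≫ 𝔗.α (one_dvd_level N) := by
    rw [Iso.refl_hom, Iso.refl_hom, Category.id_comp, Category.comp_id]
  have hcomm := (𝔗.discrepancy_comp_beta_of_transports Ψ hepi (one_dvd_level N) α₁ (a N) β₁ (b N) (hΨα N) (hΨβ N) he
    hT₁r hT₁r' hTr hTr').2.2
  rw [inv_one, one_mul, inv_one, one_mul] at hcomm
  exact hconst N (w N) (hw N) u₁ hu₁ c hcomm hc₁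

end ThetaFrobenioidTower

end Literature.AnabelianGeometry.EtaleTheta
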